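import Summits.Ventures.HodgeRepro2.T6PeriodInput4
import Summits.Ventures.HodgeRepro2.T6NAut2Toy
import Summits.Ventures.HodgeRepro2.T6N2ToyIso
import Summits.Ventures.HodgeRepro2.T6N3ToyR
import Summits.Ventures.HodgeRepro2.T6N43ExplicitToyEq
import Summits.Ventures.HodgeRepro2.T6N42ToyNSide

/-!
# T6PeriodInput4Toy — the M2 v4 theorem fires on the joint toy (README §10.5(ii)(d) for `periodInputN_of_published₄`)

Cell pub-hodge-repro2, Tier 6 (README §10), seat t6-lead (gen 4). JOINT CONSISTENCY OF THE HYPOTHESIS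
SET OF THE DECLARED M2 OBJECT (`periodInputN_of_published₄`, T6PeriodInput4, p404923): on ONE carrier —
`toyM`, the v1 toy `NAutToyN.toy` over the non-degenerate period datum `NAutToyN.toyNDatumN` with BOTH N4
sides replaced by t6-p5's consistent side `N42ToyNSide.toyNSide` (the one whose archimedean local factors
ARE the Eischen–Liu `Γ_ℂ`-products of t6-p6's N4.3 toys and whose global `L` is their product), made a v2
carrier by t6-p5's explicit-isometry N2 datum `N2ToyIso.toyIsoF` — EVERY datum / residual binder of the M2
theorem is instantiated by the owners' accepted toy lemmas, and every display whose toy form the owners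
proved is discharged on the toy as well; the theorem's conclusion there is the TRUE statement
`Hyp.PeriodN (ToyN.toyN F hw0)` (`ToyN.periodN_toyN`), so the binder set is consistent AND its conclusion
is not vacuous.

Why the lead's earlier side `NAutToy.toyNSide` is NOT used: its doubling-L datum has `Lv ≡ 1` at the real
places, and the Eischen–Liu binders of `periodInputN_of_published₄` (`hEL₁ hEL₂ hEL₃` per side) identify
`d41.Lv (Sum.inr j)` with a `Γ_ℂ`-product — on that side they are FALSE, so no joint instance exists
through it; t6-p5's `N42ToyNSide.toyNSide` (p401672) was built for exactly this seam (`L = ∏_v L_v`,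
`S` = all places, GQT Thm 11.4(ii) by `analyticAt_one_of_eischenLiu`). The lead's own NSide toy remains
the §10.5(ii)(c)/(d) witness for the v1 mains-level composition, where no Eischen–Liu binder occurs.

What is INSTANTIATED (the carrier and 113 of the 136 binders of the theorem's block): `hex` (the toy's
choices ARE the quadruples, `data = id`); N2's (N0.3)(b) properties `hfr h₁₁₁ h₁₀₀ hu` on `toyIsoF`
(`isCMFrame_frameOf`, `isLiuSignElement_e111Of`, `isLiuSignElement_e₁₀₀_of_explicit`,
`uSpec_of_magSpec`); `hAdm` (admissible sets `univ` ⟹ `AdmSpanning` ⟹ `AdmGenerating`, t6-p3's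
`admSpanning_of_univ` / `admGenerating_of_admSpanning`); the three Rogawski displays on t6-p3's packet toy
`toyR`, `hs`, the dictionary and the N3.L8 interface Props (`T6N3ToyR`); the Gan–Takeda display on the toy
shape `toyS` and the twenty N3A / N3B interface Props per side (`T6N3Toy`, `toy.A = toy.B = side`); the
explicit Fock-line bundle `XA = XB = N43Toy.explicitToy` with `hx = N43Toy.toy_hx` (T6N43ExplicitToyEq,
p404436); on each N4 side, exactly t6-p5's instantiation of the sixty-two binders of `N4_main`
(`N42ToyN4.toyJ_N4_via_N4_main`, p401831) minus the six (I-P2) binders v4 discharges itself: the N4.2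
interface Props and the Mínguez / Gan–Ichino displays on `toyFinitePlaces`, the Eischen–Liu displays on
`toyD41.Lv (Sum.inr j)` (t6-p6's `toyU2_EL` / `toyU11_EL`), (I-P2′) and Rühl's (A-2f) on `toyU11`, the three
«obvious» GQT bridges (`thetaNonzero ≡ True`), the N4.1 displays GQT Thm 11.4(ii), Lapid–Rallis §10 (global
and `p`-adic), Iwasawa §3.1 (E) ×2, Thm 3.1 ×2, Prop. 4.4 ×2 on `toyD41`, `hunr` (vacuous, `S` = all places),
GQT Thm 11.7(ii) (`σ = ⊤`), `hτ'` from t6-p3's `toy_hypI`; N5's Theorem 5.6 display on the two-element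
family `{toySide, toySide}` (t6-p7's `toySide_dichotomy`) and the residual binders `hL5 ha5 hb5 hc5` on
`toySide` (`T6N5Toy`).

What is ASSUMED (the five displays no owner toy instantiates on THIS carrier): Shimura 2008 Thm 2.2(i)
on `K` itself (`hSh`), and the four N1 displays of T6N1Hyp on the lead's non-degenerate N1 datum
`NAutToyN.toyN1N` (Voisin 2002 7.3.2, Voisin 2002 Lemma 5.4 / Petersson, Liu 2021 Prop. 4.13 A / B).
t6-p1's `N1Toy.toy_displays` proves the four on the degenerate toy `NAutToy.toyN1` (dictionary `sc = 0`,
`F_A = F_B = 0`); on `toyN1N` the dictionary is again `0` but `F_A c = c₁ · c₂` is the toy pairing, so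
Liu's identities `sc(…) = F_A c` FAIL there for `c = (1, 1, 1, 1)` whenever two indices `i < j` carry
`τ₁`: the four N1 displays are NOT jointly satisfiable on `toyN1N` as built, and a consistent N1 toy datum
over `toyNDatumN` (a non-zero dictionary realising Liu's two identities and the Petersson identity against
`∫_S` on `HBC K`) is asked of t6-p1 (N1 owner). Until it exists the four enter as hypotheses, and this
file certifies joint consistency for the OTHER 131 binders of the block (every owner display that has a
toy form, every datum / residual binder) — README §10.5(ii)(d) with one named gap, not a blanket claim.

§8(d): uses an L-value-free non-vanishing device: NO.
-/

namespace Summit.Ventures.HodgeRepro2.T6.PeriodInput4Toy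

open scoped InnerProductSpace
open NAutToyN N2ToyIso N3Toy N42Toy N42ToyNSide N43Toy N5Toy

variable {K : Type} [Field K] [NumberField K] [NumberField.IsCMField K]

/-! ## 1. The carrier -/

/-- The v1 toy carrier with t6-p5's consistent N4 side on both sides: `NAutToyN.toy` with
`sA := sB := N42ToyNSide.toyNSide`. -/
noncomputable def toyN (F : FaceSetting K) {σ : K →+* ℂ} {w : KC K} (hw : w ∈ eigenLineK K σ)
    (hw0 : w ≠ 0) : NAut F (toyNDatumN F hw hw0) where
  d3 := N3Toy.toy
  data c := c
  data_surj φa φb φc φd := ⟨(φa, φb, φc, φd), trivial, rfl⟩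
  d1 := toyN1N F hw hw0
  sA := N42ToyNSide.toyNSide
  sB := N42ToyNSide.toyNSide
  ι5 := Unit
  G5 := Multiplicative ℤ
  d5 := N5Toy.toyData
  hypII_A_of_N5 _ := N3Toy.toy_hypII
  hypII_B_of_N5 _ := N3Toy.toy_hypII

/-- The joint toy carrier: `toyN` made a v2 carrier by t6-p5's explicit-isometry N2 datum `toyIsoF` over
the toy N3 datum (t6-p5's `N2ToyJoint.d2` is this datum). -/
noncomputable def toyM (F : FaceSetting K) {σ : K →+* ℂ} {w : KC K} (hw : w ∈ eigenLineK K σ)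
    (hw0 : w ≠ 0) : NAut2 F (toyNDatumN F hw hw0) :=
  NAut2.ofNAut (toyN F hw hw0) (toyIsoF F (toyNDatumN F hw hw0) N3Toy.toy)

section Carrier

variable (F : FaceSetting K) {σ : K →+* ℂ} {w : KC K} (hw : w ∈ eigenLineK K σ) (hw0 : w ≠ 0)

/-- `hex`: every quadruple of Schwartz data is the data of a choice (`data = id` on the toy). -/
theorem toyM_hex : ∀ (φa : (toyM F hw hw0).d3.A.Sa) (φb : (toyM F hw hw0).d3.A.Sb)
    (φc : (toyM F hw hw0).d3.B.Sa) (φd : (toyM F hw hw0).d3.B.Sb),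
    ∃ c, (toyM F hw hw0).data c = (φa, φb, φc, φd) :=
  fun φa φb φc φd => ⟨(φa, φb, φc, φd), rfl⟩

/-! ## 2. N2: the (N0.3)(b) properties of the explicit-isometry datum -/

/-- `hfr`: the toy frame is a CM frame (t6-p5). -/
theorem toyM_fr : T5CubeTypes.IsCMFrame (toyM F hw hw0).d2.τ :=
  isCMFrame_frameOf F.deg6

/-- `h₁₁₁`: the sign element of type `111` is μ-admissible (t6-p5). -/
theorem toyM_e111 :
    IsLiuSignElement K ((toyM F hw hw0).d2.type T5DatumSimilitude.t111) (toyM F hw hw0).d2.e₁₁₁ :=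
  isLiuSignElement_e111Of (isCMFrame_frameOf F.deg6)

/-- `h₁₀₀`: the sign element of type `100` is μ-admissible (t6-p5, the explicit isometry). -/
theorem toyM_e100 :
    IsLiuSignElement K ((toyM F hw hw0).d2.type T5DatumSimilitude.t100) (toyM F hw hw0).d2.e₁₀₀ :=
  isLiuSignElement_e₁₀₀_of_explicit (toyM F hw hw0).d2 (toyM_fr F hw hw0) (toyM_e111 F hw hw0)
    (magSpec_uOf (isCMFrame_frameOf F.deg6)) rfl

/-- `hu`: the similitude scalar has the required signs and magnitudes (t6-p5). -/
theorem toyM_uSpec : N2Main.USpec (toyM F hw hw0).d2 :=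
  uSpec_of_magSpec (toyM F hw hw0).d2 (toyM_fr F hw hw0) (magSpec_uOf (isCMFrame_frameOf F.deg6))

/-- `hAdm`: the sentence N2 and N3 share holds on the toy — the admissible sets are `univ`. -/
theorem toyM_admGenerating : (toyM F hw hw0).d2.AdmGenerating :=
  (toyM F hw hw0).d2.admGenerating_of_admSpanning
    ((toyM F hw hw0).d2.admSpanning_of_univ rfl rfl rfl rfl)

end Carrier

/-! ## 3. N4: t6-p5's consistent toy side -/

/-- The «obvious» direction of GQT Conj. 11.5 at a real place of the toy side (`thetaNonzero ≡ True`). -/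
theorem toyNSide_conj11_5 {H : Type*} [MeasurableSpace H] {P : Matrix (Fin 2) (Fin 2) ℂ → Prop}
    (𝒟 : ArchDoublingDatum H P) (j : Fin 3) :
    Hyp.GQT2014_Conj11_5_obvious 𝒟 N42ToyNSide.toyNSide.d41 (Sum.inr j) :=
  fun _ => trivial

/-- GQT Thm 11.7(ii) on the toy N3 side and t6-p5's toy doubling-L datum (`σ = ⊤ ≠ ⊥`). -/
theorem toyD41_thm11_7 : Hyp.GQT2014_Thm11_7_ii N3Toy.toy.A N42ToyNSide.toyD41 := fun _ _ => by simp

/-- (I-P2′) at τ′₂ / τ′₃ of the toy side: t6-p6's `toyU11_lowest`. -/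
theorem toyNSide_lowest : N42ToyNSide.toyNSide.d43.d₂.LowestWeightCoefficient := toyU11_lowest

/-- Rühl's (A-2f) at τ′₂ / τ′₃ of the toy side: t6-p6's `toyU11_A2f`. -/
theorem toyNSide_A2f : Hyp.Ruhl1970_A2f N42ToyNSide.toyNSide.d43.d₂ := toyU11_A2f

/-! ## 4. N5: the two-element family -/

/-- Theorem 5.6's display on the two sides of the toy N5 datum (both the trivial side). -/
theorem toyData_thm5_6 :
    Hyp.BFGYYZ2025_Thm5_6 ({N5Toy.toyData.A, N5Toy.toyData.B} : Set (N5Skeleton.ToricSide Unit (Multiplicative ℤ))) := by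
  intro X hX
  simp only [Set.mem_insert_iff, Set.mem_singleton_iff] at hX
  rcases hX with rfl | rfl <;> exact toySide_dichotomy

/-! ## 5. The M2 theorem on the joint toy -/

/-- THE DECLARED M2 OBJECT FIRES ON THE JOINT TOY: with the five assumed displays (Shimura 2008 Thm 2.2(i)
on `K`; the four N1 displays on the non-degenerate toy N1 datum — see the module docstring for why these
four are NOT yet known to be satisfiable on `toyN1N`), `periodInputN_of_published₄` applies to `toyM` with
EVERY OTHER BINDER a theorem on the toy — README §10.5(ii)(d) for the hypothesis set of the M2 composition
contract, modulo the N1 gap; the conclusion is `Hyp.PeriodN (ToyN.toyN F hw0)`, which holds outright. -/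
theorem toy_periodInputN_of_published₄ (F : FaceSetting K) {σ : K →+* ℂ} {w : KC K}
    (hw : w ∈ eigenLineK K σ) (hw0 : w ≠ 0)
    (hSh : Hyp.Shimura2008_Thm2_2_i K)
    (hN1H : Hyp.Voisin2002_7_3_2 (toyM F hw hw0).d1)
    (hN1L : Hyp.Voisin2002_Lemma5_4_petersson (toyM F hw hw0).d1)
    (hN1A : Hyp.Liu2021_Prop4_13_vertexLiftA (toyM F hw hw0).d1)
    (hN1B : Hyp.Liu2021_Prop4_13_vertexLiftB (toyM F hw hw0).d1) :
    ∃ c, (toyNDatumN F hw hw0).AdmChoice c ∧ Hyp.PeriodN ((toyNDatumN F hw hw0).shadow c) :=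
  periodInputN_of_published₄ (toyM F hw hw0) (toyM_hex F hw hw0)
    -- N2
    (toyM_fr F hw hw0) (toyM_e111 F hw hw0) (toyM_e100 F hw hw0) (toyM_uSpec F hw hw0) hSh
    -- N3iso
    (toyM_admGenerating F hw hw0) toyR toyR_partition toyR_thm14_6_4 toyR_thm14_6_5 toyR_hs
    toy_AutStable toy_RogawskiBridge toy_AutOrthogonal toy_AutSimple toy_ProductsIn20
    toy_ProductEquivariant toy_ProductsIn20 toy_ProductEquivariant toy_SigmaIsAut rfl
    -- N1 (assumed displays)
    hN1H hN1L hN1A hN1B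
    -- N3A
    (fun _ : Unit => toyS) (fun _ => toyS_ganTakeda) toy_HoweDualityBridge toy_KliftCont toy_Seam
    toy_Adjoint toy_KliftLevel toy_ThetaTauType toy_CopiesEquivariant toy_CopiesOrthogonal
    toy_CopiesIncl toy_CopiesTauType toy_TauTypeDecomposes toy_LevelPartFinite toy_LevelPartCont
    toy_KAverage toy_ThetaEquivariant toy_SpanOfFixedVector toy_CrossCopyOrthogonal
    toy_CopyIndependence toy_TensorsSpan
    -- N3B (the toy's side B is its side A)
    (fun _ : Unit => toyS) (fun _ => toyS_ganTakeda) toy_HoweDualityBridge toy_KliftCont toy_Seam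
    toy_Adjoint toy_KliftLevel toy_ThetaTauType toy_CopiesEquivariant toy_CopiesOrthogonal
    toy_CopiesIncl toy_CopiesTauType toy_TauTypeDecomposes toy_LevelPartFinite toy_LevelPartCont
    toy_KAverage toy_ThetaEquivariant toy_SpanOfFixedVector toy_CrossCopyOrthogonal
    toy_CopyIndependence toy_TensorsSpan
    -- N4: the explicit bundles
    explicitToy explicitToy toy_hx toy_hx
    -- N4, side A: N4.2 (t6-p5's toy instances, as in `toyJ_N4_via_N4_main`)
    ⟨fun _ => ⟨toyPair_irreducible, toyPair_smooth⟩, fun _ => ⟨trivial_irreducible, trivial_smooth⟩⟩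
    (fun _ => Nat.zero_lt_succ 1) (fun _ => Nat.le_succ 2) (fun _ => toyTower_firstLift)
    (fun _ => toyTypeII_minguez) (fun _ => toyTower_ganIchino)
    -- side A: N4.3 (t6-p6's toy instances; the Eischen–Liu binders on `toyD41.Lv (Sum.inr j)`)
    toyU2_EL toyNSide_lowest toyNSide_A2f toyU11_EL toyNSide_lowest toyNSide_A2f toyU11_EL
    -- side A: the three «obvious» bridges, N4.1 (t6-p5's instances on `toyD41`), `hunr`, the Rallis
    -- bridge, the τ′-refinement
    (toyNSide_conj11_5 _ 0) (toyNSide_conj11_5 _ 1) (toyNSide_conj11_5 _ 2)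
    toyD41_GQT toyD41_LR toyD41_padic toyD41_eulerE₁ toyD41_eulerE₂ toyD41_thm31₁ toyD41_thm31₂
    toyD41_prop44₁ toyD41_prop44₂ toyD41_hunr toyD41_thm11_7 (fun _ => toy_hypI)
    -- N4, side B: the same
    ⟨fun _ => ⟨toyPair_irreducible, toyPair_smooth⟩, fun _ => ⟨trivial_irreducible, trivial_smooth⟩⟩
    (fun _ => Nat.zero_lt_succ 1) (fun _ => Nat.le_succ 2) (fun _ => toyTower_firstLift)
    (fun _ => toyTypeII_minguez) (fun _ => toyTower_ganIchino)
    toyU2_EL toyNSide_lowest toyNSide_A2f toyU11_EL toyNSide_lowest toyNSide_A2f toyU11_EL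
    (toyNSide_conj11_5 _ 0) (toyNSide_conj11_5 _ 1) (toyNSide_conj11_5 _ 2)
    toyD41_GQT toyD41_LR toyD41_padic toyD41_eulerE₁ toyD41_eulerE₂ toyD41_thm31₁ toyD41_thm31₂
    toyD41_prop44₁ toyD41_prop44₂ toyD41_hunr toyD41_thm11_7 (fun _ => toy_hypI)
    -- N5
    toyData_thm5_6 ⟨toySide_levelReduction, toySide_levelReduction⟩ ⟨toySide_condA, toySide_condA⟩
    ⟨toySide_condB, toySide_condB⟩ ⟨toySide_condC, toySide_condC⟩

omit [NumberField.IsCMField K] in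
/-- The conclusion on the toy is not vacuous: the shadow of every choice is `ToyN.toyN F hw0`, whose
period input holds outright. -/
theorem toy_conclusion_holds (F : FaceSetting K) {σ : K →+* ℂ} {w : KC K}
    (hw : w ∈ eigenLineK K σ) (hw0 : w ≠ 0) (c : (toyNDatumN F hw hw0).Choice) :
    Hyp.PeriodN ((toyNDatumN F hw hw0).shadow c) :=
  ToyN.periodN_toyN F hw0 hw

end Summit.Ventures.HodgeRepro2.T6.PeriodInput4Toy
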